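import Summits.Ventures.PercRepro.C026C028DeleteEdge
import Summits.Ventures.PercRepro.C026Independence

/-!
# Gluing at sure clusters, stage 1: the path lemma (p6, gen 15; the last piece of THEOREM T3's
graph dictionary)

A *cluster gluing* of `(G, p)` at the terminals `a, b, c`: the edges are coloured, and every sure
cluster (under `p`) that contains no terminal has all its non-sure edges of one colour
(`IsClusterGluing`).  The two *parts* are the subgraphs of the edges of one colour TOGETHER WITH all
surely-open edges (`sideOrSure`), so every sure cluster is connected inside each part.  On a
configuration opening every sure edge, the isolation of a terminal from the other two holds in `G` iff
it holds in both parts (`isoMark_clusterGluing_iff`) — the a.s. form of p5's `isoMark_gluing_iff`.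
Stage 2 (successor): the probabilities multiply (the parts' events are a.s. determined by the disjoint
sets of non-sure edges of each colour; `prob_inter_eq_mul_of_dependsOn`).
-/

namespace PercRepro

/-- The colouring «of colour `s` or surely open». -/
noncomputable def sideOrSure {E : Type*} (p : E → ℝ) (side : E → Bool) (s : Bool) : E → Bool :=
  fun e => decide (side e = s ∨ p e = 1)

namespace MultiGraph

variable {V E : Type*} (G : MultiGraph V E) [Fintype E] [DecidableEq E]

/-- A vertex of a terminal cluster. -/
def InTerminal (p : E → ℝ) (a b c : V) (v : V) : Prop :=
  G.SureConn p a v ∨ G.SureConn p b v ∨ G.SureConn p c v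

/-- **Cluster gluing**: every sure cluster containing no terminal has all its non-sure edges of one
colour. -/
def IsClusterGluing (p : E → ℝ) (a b c : V) (side : E → Bool) : Prop :=
  ∀ v v', G.SureConn p v v' → ¬ G.InTerminal p a b c v →
    ∀ e e', G.EdgeAt e v → G.EdgeAt e' v' → p e ≠ 1 → p e' ≠ 1 → side e = side e'

omit [Fintype E] [DecidableEq E] in
/-- A surely-open edge lies in both parts. -/
theorem sideOrSure_of_sure {p : E → ℝ} (side : E → Bool) (s : Bool) {e : E} (he : p e = 1) :
    sideOrSure p side s e = true := by simp [sideOrSure, he]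

omit [Fintype E] [DecidableEq E] in
/-- An edge of colour `s` lies in the part of colour `s`. -/
theorem sideOrSure_of_side {p : E → ℝ} (side : E → Bool) {s : Bool} {e : E} (he : side e = s) :
    sideOrSure p side s e = true := by simp [sideOrSure, he]

omit [Fintype E] [DecidableEq E] in
/-- On a configuration opening every sure edge, a sure connection is a connection inside each part. -/
theorem conn_part_of_sureConn {p : E → ℝ} (side : E → Bool) (s : Bool) {ω : Config E}
    (hω : ∀ e, p e = 1 → ω e = true) {u v : V} (h : G.SureConn p u v) :
    (G.part (sideOrSure p side s) true).Conn (sideRestrict ω (sideOrSure p side s) true) u v := by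
  unfold SureConn at h
  refine Conn.induction (motive := fun v => (G.part (sideOrSure p side s) true).Conn
    (sideRestrict ω (sideOrSure p side s) true) u v) (Conn.refl _ _ u) ?_ h
  intro x y _ hadj ih
  obtain ⟨e, he, hends⟩ := hadj
  have he1 : p e = 1 := by simpa [sureConfig] using he
  have hopen : ω e = true := hω e he1
  have hcol := sideOrSure_of_sure side s he1
  have hstep : (G.part (sideOrSure p side s) (sideOrSure p side s e)).OpenAdj
      (sideRestrict ω (sideOrSure p side s) (sideOrSure p side s e)) x y :=
    G.openAdj_part_of_open hopen hends
  rw [hcol] at hstep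
  exact ih.tail hstep

omit [Fintype E] [DecidableEq E] in
/-- An open edge of colour `s` is a step of the part of colour `s`. -/
theorem openAdj_part_sideOrSure_of_open {p : E → ℝ} (side : E → Bool) {s : Bool} {ω : Config E}
    {e : E} (hopen : ω e = true) (hcol : sideOrSure p side s e = true) {x y : V}
    (hends : (G.fst e = x ∧ G.snd e = y) ∨ (G.fst e = y ∧ G.snd e = x)) :
    (G.part (sideOrSure p side s) true).OpenAdj (sideRestrict ω (sideOrSure p side s) true) x y := by
  have hstep : (G.part (sideOrSure p side s) (sideOrSure p side s e)).OpenAdj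
      (sideRestrict ω (sideOrSure p side s) (sideOrSure p side s e)) x y :=
    G.openAdj_part_of_open hopen hends
  rw [hcol] at hstep
  exact hstep

omit [Fintype E] [DecidableEq E] in
/-- A terminal vertex's cluster: `InTerminal` through the cover of the terminals by `m, x, y`. -/
theorem inTerminal_cases {p : E → ℝ} {a b c : V} {m x y : V}
    (hcover : ∀ w, (w = a ∨ w = b ∨ w = c) → w ≠ m → w = x ∨ w = y) {w : V}
    (hw : G.InTerminal p a b c w) :
    G.SureConn p m w ∨ G.SureConn p x w ∨ G.SureConn p y w := by
  classical
  have key : ∀ t, (t = a ∨ t = b ∨ t = c) → G.SureConn p t w →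
      G.SureConn p m w ∨ G.SureConn p x w ∨ G.SureConn p y w := by
    intro t ht hconn
    by_cases htm : t = m
    · exact Or.inl (htm ▸ hconn)
    · rcases hcover t ht htm with rfl | rfl
      · exact Or.inr (Or.inl hconn)
      · exact Or.inr (Or.inr hconn)
  rcases hw with h | h | h
  · exact key a (Or.inl rfl) h
  · exact key b (Or.inr (Or.inl rfl)) h
  · exact key c (Or.inr (Or.inr rfl)) h

omit [Fintype E] [DecidableEq E] in
/-- **The path lemma of a cluster gluing**: on a configuration opening every sure edge, a connection of
`G` from the terminal `m` to `u` gives: in some part `m` reaches `x` or `y`; or `u` lies in the sure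
cluster of `m`; or `u` lies in a non-terminal cluster of colour `s` and `m` reaches `u` in the part `s`. -/
theorem conn_part_of_clusterGluing {p : E → ℝ} {a b c : V} {side : E → Bool}
    (hg : G.IsClusterGluing p a b c side) {ω : Config E} (hω : ∀ e, p e = 1 → ω e = true)
    {m x y : V} (hcover : ∀ w, (w = a ∨ w = b ∨ w = c) → w ≠ m → w = x ∨ w = y)
    {u : V} (h : G.Conn ω m u) :
    (∃ s, (G.part (sideOrSure p side s) true).Conn (sideRestrict ω (sideOrSure p side s) true) m x ∨
      (G.part (sideOrSure p side s) true).Conn (sideRestrict ω (sideOrSure p side s) true) m y) ∨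
    G.SureConn p m u ∨
    (∃ s, (G.part (sideOrSure p side s) true).Conn (sideRestrict ω (sideOrSure p side s) true) m u ∧
      ¬ G.InTerminal p a b c u ∧
      ∀ v' e, G.SureConn p u v' → G.EdgeAt e v' → p e ≠ 1 → side e = s) := by
  -- the classification of the far end of a step
  have classify : ∀ (s : Bool) (w : V) (e : E), G.EdgeAt e w → p e ≠ 1 → side e = s →
      (G.part (sideOrSure p side s) true).Conn (sideRestrict ω (sideOrSure p side s) true) m w →
      (∃ s, (G.part (sideOrSure p side s) true).Conn (sideRestrict ω (sideOrSure p side s) true) m x ∨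
        (G.part (sideOrSure p side s) true).Conn (sideRestrict ω (sideOrSure p side s) true) m y) ∨
      G.SureConn p m w ∨
      (∃ s, (G.part (sideOrSure p side s) true).Conn (sideRestrict ω (sideOrSure p side s) true) m w ∧
        ¬ G.InTerminal p a b c w ∧
        ∀ v' e, G.SureConn p w v' → G.EdgeAt e v' → p e ≠ 1 → side e = s) := by
    intro s w e hew he1 hes hmw
    by_cases hT : G.InTerminal p a b c w
    · rcases G.inTerminal_cases hcover hT with hmw' | hxw | hyw
      · exact Or.inr (Or.inl hmw')
      · exact Or.inl ⟨s, Or.inl (hmw.trans (G.conn_part_of_sureConn side s hω (Conn.symm hxw)))⟩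
      · exact Or.inl ⟨s, Or.inr (hmw.trans (G.conn_part_of_sureConn side s hω (Conn.symm hyw)))⟩
    · refine Or.inr (Or.inr ⟨s, hmw, hT, fun v' e' hwv' he'v' he'1 => ?_⟩)
      rw [← hes]
      exact (hg w v' hwv' hT e e' hew he'v' he1 he'1).symm
  refine Conn.induction (motive := fun u =>
    (∃ s, (G.part (sideOrSure p side s) true).Conn (sideRestrict ω (sideOrSure p side s) true) m x ∨
      (G.part (sideOrSure p side s) true).Conn (sideRestrict ω (sideOrSure p side s) true) m y) ∨
    G.SureConn p m u ∨
    (∃ s, (G.part (sideOrSure p side s) true).Conn (sideRestrict ω (sideOrSure p side s) true) m u ∧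
      ¬ G.InTerminal p a b c u ∧
      ∀ v' e, G.SureConn p u v' → G.EdgeAt e v' → p e ≠ 1 → side e = s)) ?_ ?_ h
  · exact Or.inr (Or.inl (Conn.refl G _ m))
  · intro u w _ hadj ih
    obtain ⟨e, he, hends⟩ := hadj
    have heu : G.EdgeAt e u := by
      rcases hends with ⟨h1, _⟩ | ⟨_, h2⟩
      · exact Or.inl h1
      · exact Or.inr h2
    have hew : G.EdgeAt e w := by
      rcases hends with ⟨_, h2⟩ | ⟨h1, _⟩
      · exact Or.inr h2
      · exact Or.inl h1
    rcases ih with hdone | hmu | ⟨s, hmu, hnot, hcol⟩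
    · exact Or.inl hdone
    · -- `u` in the cluster of `m`
      by_cases he1 : p e = 1
      · exact Or.inr (Or.inl (Conn.trans hmu (G.sureConn_of_sure_edge he1 hends)))
      · have hmu' := G.conn_part_of_sureConn side (side e) hω hmu
        have hmw : (G.part (sideOrSure p side (side e)) true).Conn
            (sideRestrict ω (sideOrSure p side (side e)) true) m w :=
          hmu'.tail (G.openAdj_part_sideOrSure_of_open side he
            (sideOrSure_of_side side rfl) hends)
        exact classify (side e) w e hew he1 rfl hmw
    · -- `u` in a non-terminal cluster of colour `s`
      by_cases he1 : p e = 1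
      · have hsure : G.SureConn p u w := G.sureConn_of_sure_edge he1 hends
        refine Or.inr (Or.inr ⟨s, hmu.tail (G.openAdj_part_sideOrSure_of_open side he
          (sideOrSure_of_sure side s he1) hends), ?_, fun v' e' hwv' he'v' he'1 =>
            hcol v' e' (Conn.trans hsure hwv') he'v' he'1⟩)
        intro hw
        apply hnot
        rcases hw with h | h | h
        · exact Or.inl (Conn.trans h (Conn.symm hsure))
        · exact Or.inr (Or.inl (Conn.trans h (Conn.symm hsure)))
        · exact Or.inr (Or.inr (Conn.trans h (Conn.symm hsure)))
      · have hes : side e = s := hcol u e (Conn.refl G _ u) heu he1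
        have hmw : (G.part (sideOrSure p side s) true).Conn
            (sideRestrict ω (sideOrSure p side s) true) m w :=
          hmu.tail (G.openAdj_part_sideOrSure_of_open side he
            (sideOrSure_of_side side hes) hends)
        exact classify s w e hew he1 hes hmw

omit [Fintype E] [DecidableEq E] in
/-- **Isolation across a cluster gluing** (the a.s. form of `isoMark_gluing_iff`): on a configuration
opening every sure edge, the terminal `m` is isolated from the terminals `x`, `y` in `G` iff it is so in
both parts. -/
theorem isoMark_clusterGluing_iff {p : E → ℝ} {a b c : V} {side : E → Bool}
    (hg : G.IsClusterGluing p a b c side) {ω : Config E} (hω : ∀ e, p e = 1 → ω e = true)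
    {m x y : V} (hx : x = a ∨ x = b ∨ x = c) (hy : y = a ∨ y = b ∨ y = c)
    (hcover : ∀ w, (w = a ∨ w = b ∨ w = c) → w ≠ m → w = x ∨ w = y) :
    G.IsoMark ω m x y ↔
      (G.part (sideOrSure p side true) true).IsoMark (sideRestrict ω (sideOrSure p side true) true)
          m x y ∧
        (G.part (sideOrSure p side false) true).IsoMark
          (sideRestrict ω (sideOrSure p side false) true) m x y := by
  unfold IsoMark
  constructor
  · rintro ⟨hmx, hmy⟩
    exact ⟨⟨fun h => hmx (Conn.of_part h), fun h => hmy (Conn.of_part h)⟩,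
      ⟨fun h => hmx (Conn.of_part h), fun h => hmy (Conn.of_part h)⟩⟩
  · rintro ⟨⟨hTx, hTy⟩, ⟨hFx, hFy⟩⟩
    have hin : ∀ w, (w = a ∨ w = b ∨ w = c) → G.InTerminal p a b c w := by
      intro w hw
      rcases hw with rfl | rfl | rfl
      · exact Or.inl (Conn.refl G _ _)
      · exact Or.inr (Or.inl (Conn.refl G _ _))
      · exact Or.inr (Or.inr (Conn.refl G _ _))
    have hbool : ∀ s : Bool, s = true ∨ s = false := fun s => by cases s <;> simp
    -- a connection to `x` or to `y` in some part contradicts the parts' isolations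
    have hdone : ¬ ∃ s, (G.part (sideOrSure p side s) true).Conn
        (sideRestrict ω (sideOrSure p side s) true) m x ∨
        (G.part (sideOrSure p side s) true).Conn (sideRestrict ω (sideOrSure p side s) true) m y := by
      rintro ⟨s, h⟩
      rcases hbool s with rfl | rfl
      · rcases h with h | h
        · exact hTx h
        · exact hTy h
      · rcases h with h | h
        · exact hFx h
        · exact hFy h
    refine ⟨fun h => ?_, fun h => ?_⟩
    · rcases G.conn_part_of_clusterGluing hg hω hcover h with hd | hs | ⟨_, _, hnot, _⟩
      · exact hdone hd
      · exact hTx (G.conn_part_of_sureConn side true hω hs)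
      · exact hnot (hin x hx)
    · rcases G.conn_part_of_clusterGluing hg hω hcover h with hd | hs | ⟨_, _, hnot, _⟩
      · exact hdone hd
      · exact hTy (G.conn_part_of_sureConn side true hω hs)
      · exact hnot (hin y hy)

/-! ### Stage 2: the probabilities multiply -/

end MultiGraph

/-- The configuration with every sure edge forced open. -/
noncomputable def forceSure {E : Type*} (p : E → ℝ) (ω : Config E) : Config E :=
  fun e => if p e = 1 then true else ω e

/-- On a positive-weight configuration, forcing the sure edges changes nothing. -/
theorem forceSure_eq_of_pos {E : Type*} [Fintype E] {p : E → ℝ} {ω : Config E}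
    (hω : 0 < weight p ω) : forceSure p ω = ω := by
  funext e
  unfold forceSure
  split_ifs with h
  · exact (eq_true_of_weight_pos hω h).symm
  · rfl

/-- The non-sure edges of colour `s`. -/
noncomputable def nonSureSide {E : Type*} [Fintype E] (p : E → ℝ) (side : E → Bool) (s : Bool) :
    Finset E :=
  Finset.univ.filter fun e => side e = s ∧ p e ≠ 1

/-- An event read on the part of colour `s` of the sure-forced configuration depends only on the
non-sure edges of colour `s`. -/
theorem dependsOn_nonSureSide {E : Type*} [Fintype E] (p : E → ℝ) (side : E → Bool) (s : Bool)
    (P : Config {e // sideOrSure p side s e = true} → Prop) :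
    DependsOn (nonSureSide p side s)
      {ω | P (sideRestrict (forceSure p ω) (sideOrSure p side s) true)} := by
  intro ω ω' h
  have : sideRestrict (forceSure p ω) (sideOrSure p side s) true =
      sideRestrict (forceSure p ω') (sideOrSure p side s) true := by
    funext e
    simp only [sideRestrict, forceSure]
    split_ifs with h1
    · rfl
    · have he : side e.1 = s := by
        have := e.2
        simp only [sideOrSure, decide_eq_true_eq] at this
        rcases this with h2 | h2
        · exact h2
        · exact absurd h2 h1
      exact h e.1 (by simp [nonSureSide, he, h1])
  simp only [Set.mem_setOf_eq, this]

/-- `DependsOn` is monotone in the edge set. -/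
theorem DependsOn.mono {E : Type*} {S S' : Finset E} (hSS : S ⊆ S') {A : Set (Config E)}
    (h : DependsOn S A) : DependsOn S' A :=
  fun ω ω' hω => h ω ω' fun e he => hω e (hSS he)

/-- The non-sure edges of the two colours are disjoint. -/
theorem nonSureSide_false_subset_compl {E : Type*} [Fintype E] [DecidableEq E] (p : E → ℝ)
    (side : E → Bool) : nonSureSide p side false ⊆ (nonSureSide p side true)ᶜ := by
  intro e he
  simp only [nonSureSide, Finset.mem_filter, Finset.mem_univ, true_and] at he
  simp only [Finset.mem_compl, nonSureSide, Finset.mem_filter, Finset.mem_univ, true_and, not_and]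
  intro h
  rw [h] at he
  exact absurd he.1 (by decide)

namespace MultiGraph

variable {V E : Type*} (G : MultiGraph V E) [Fintype E] [DecidableEq E]

/-- **A mark's isolation multiplies over a cluster gluing**: `P(m iso) = P(m iso in part true)·P(m iso
in part false)` at every weight vector. -/
theorem prob_isoMark_clusterGluing {p : E → ℝ} (hp : IsProb p) {a b c : V} {side : E → Bool}
    (hg : G.IsClusterGluing p a b c side) {m x y : V} (hx : x = a ∨ x = b ∨ x = c)
    (hy : y = a ∨ y = b ∨ y = c) (hcover : ∀ w, (w = a ∨ w = b ∨ w = c) → w ≠ m → w = x ∨ w = y) :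
    prob p {ω | G.IsoMark ω m x y} =
      prob p {ω | (G.part (sideOrSure p side true) true).IsoMark
          (sideRestrict ω (sideOrSure p side true) true) m x y} *
        prob p {ω | (G.part (sideOrSure p side false) true).IsoMark
          (sideRestrict ω (sideOrSure p side false) true) m x y} := by
  -- the sure-forced versions of the two side events
  set ET := {ω : Config E | (G.part (sideOrSure p side true) true).IsoMark
    (sideRestrict (forceSure p ω) (sideOrSure p side true) true) m x y} with hET
  set EF := {ω : Config E | (G.part (sideOrSure p side false) true).IsoMark
    (sideRestrict (forceSure p ω) (sideOrSure p side false) true) m x y} with hEF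
  have h1 : prob p {ω | G.IsoMark ω m x y} = prob p (ET ∩ EF) := by
    refine prob_eq_of_eqOn_pos hp fun ω hω => ?_
    have hω' : ∀ e, p e = 1 → ω e = true := fun e he => eq_true_of_weight_pos hω he
    simp only [Set.mem_setOf_eq, Set.mem_inter_iff, hET, hEF, forceSure_eq_of_pos hω]
    exact G.isoMark_clusterGluing_iff hg hω' hx hy hcover
  have hDT : DependsOn (nonSureSide p side true) ET := by
    rw [hET]
    exact dependsOn_nonSureSide p side true
      (fun τ => (G.part (sideOrSure p side true) true).IsoMark τ m x y)
  have hDF : DependsOn (nonSureSide p side true)ᶜ EF := by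
    rw [hEF]
    exact (dependsOn_nonSureSide p side false
      (fun τ => (G.part (sideOrSure p side false) true).IsoMark τ m x y)).mono
      (nonSureSide_false_subset_compl p side)
  have h2 : prob p (ET ∩ EF) = prob p ET * prob p EF :=
    prob_inter_eq_mul_of_dependsOn p hDT hDF
  have h3 : prob p ET = prob p {ω | (G.part (sideOrSure p side true) true).IsoMark
      (sideRestrict ω (sideOrSure p side true) true) m x y} := by
    refine prob_eq_of_eqOn_pos hp fun ω hω => ?_
    simp only [Set.mem_setOf_eq, hET, forceSure_eq_of_pos hω]
  have h4 : prob p EF = prob p {ω | (G.part (sideOrSure p side false) true).IsoMark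
      (sideRestrict ω (sideOrSure p side false) true) m x y} := by
    refine prob_eq_of_eqOn_pos hp fun ω hω => ?_
    simp only [Set.mem_setOf_eq, hEF, forceSure_eq_of_pos hω]
  rw [h1, h2, h3, h4]

end MultiGraph

end PercRepro
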